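import Summits.CriticalPhenomena.SAWScalingLimit.Theorems.SAWLoopFugacityFlowAvoidanceLimitWindingCalculus
import Summits.CriticalPhenomena.SAWScalingLimit.Theorems.SAWLoopFugacityFlowAvoidanceLimitWindingFaceK
import HarnessLib

/-!
# Winding bookkeeping for the shielding lemma: rows and columns of faces, certified sites

Sub-problem `CriticalPhenomena/SAWScalingLimit`, crux `AvoidanceLimit`, line `symplectic-fermion-anchor`
(lead c5, §shield). For a CLOSED lattice walk `p` of `ℤ²` (the loop `λ = L̂ · Far · γ⁻¹ · In` of the
shielding lemma):

* `walkWinding_row_eq` — the winding number is constant along a horizontal row of faces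
  `(X₀ + j, Y)`, `j ≤ n`, provided none of the separating vertical edges
  `{(X₀ + j, Y), (X₀ + j, Y + 1)}`, `1 ≤ j ≤ n`, is an edge of `p`;
* `walkWinding_col_eq` — the same along a vertical column of faces `(X, Y₀ + j)` when none of the
  separating horizontal edges `{(X, Y₀ + j), (X + 1, Y₀ + j)}`, `1 ≤ j ≤ n`, is an edge of `p`;
* `segment_subset_of_walkWinding_ne_zero` — **certified sites have certified edges**: if
  `v ∉ p.support`, `walkWinding p v ≠ 0` and the polygon of `p` winds `0` times about the points of
  a set `K` off the polygon, then the four closed unit segments issuing from `v` lie in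
  `Kᶜ ∪ range (walkPath p)` (the three faces `v`, `v - e₀`, `v - e₁` carry the winding number of
  `v`, `walkWinding_faces_eq_of_not_mem_support`, and `face_subset_of_walkWinding_ne_zero'`).

All statements are [folklore].
-/

noncomputable section

open scoped BigOperators Classical
open Set Complex SimpleGraph
open Literature.Topology.PlaneTopology
open Literature.Probability.Percolation (walkWinding walkWinding_eq_walkWinding_right walkWinding_eq_walkWinding_up_of_closed)
open Literature.Probability.LatticeModels

namespace Summit.CriticalPhenomena.SAWScalingLimit.Theorems.AvoidanceLimit.Anchor

/-! ### Rows and columns of faces -/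

/-- **Constancy along a row of faces.** If none of the vertical edges
`{(X₀ + j, Y), (X₀ + j, Y + 1)}`, `1 ≤ j ≤ n`, is an edge of the closed walk `p`, then the faces with
lower-left corners `(X₀, Y)` and `(X₀ + n, Y)` have the same winding number. [folklore] -/
theorem walkWinding_row_eq :
    ∀ {a : Site 2} (p : (zdGraph 2).Walk a a) (X₀ Y : ℤ) (n : ℕ),
      (∀ j : ℕ, 1 ≤ j → j ≤ n → s((![X₀ + j, Y] : Site 2), ![X₀ + j, Y + 1]) ∉ p.edges) →
      walkWinding p ![X₀, Y] = walkWinding p ![X₀ + n, Y] := by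
  intro a p X₀ Y n h
  have vec2_add_single_zero : ∀ X Y : ℤ, (![X, Y] : Site 2) + Pi.single 0 1 = ![X + 1, Y] := fun X Y => by
    ext i; fin_cases i <;> simp
  have vec2_add_single_one : ∀ X Y : ℤ, (![X, Y] : Site 2) + Pi.single 1 1 = ![X, Y + 1] := fun X Y => by
    ext i; fin_cases i <;> simp
  induction n with
  | zero => simp
  | succ n ih =>
    have h' := ih (fun j hj hjn => h j hj (by omega))
    rw [h']
    have key := walkWinding_eq_walkWinding_right (p := p) (u := ![X₀ + n, Y])
      (by
        rw [vec2_add_single_zero, vec2_add_single_one]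
        have := h (n + 1) (by omega) le_rfl
        push_cast at this ⊢
        rwa [show X₀ + (n : ℤ) + 1 = X₀ + (n + 1) by ring])
    rw [vec2_add_single_zero] at key
    push_cast
    rwa [show X₀ + ((n : ℤ) + 1) = X₀ + n + 1 by ring]

/-- **Constancy along a column of faces.** If none of the horizontal edges
`{(X, Y₀ + j), (X + 1, Y₀ + j)}`, `1 ≤ j ≤ n`, is an edge of the closed walk `p`, then the faces with
lower-left corners `(X, Y₀)` and `(X, Y₀ + n)` have the same winding number. [folklore] -/
theorem walkWinding_col_eq :
    ∀ {a : Site 2} (p : (zdGraph 2).Walk a a) (X Y₀ : ℤ) (n : ℕ),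
      (∀ j : ℕ, 1 ≤ j → j ≤ n → s((![X, Y₀ + j] : Site 2), ![X + 1, Y₀ + j]) ∉ p.edges) →
      walkWinding p ![X, Y₀] = walkWinding p ![X, Y₀ + n] := by
  intro a p X Y₀ n h
  have vec2_add_single_zero : ∀ X Y : ℤ, (![X, Y] : Site 2) + Pi.single 0 1 = ![X + 1, Y] := fun X Y => by
    ext i; fin_cases i <;> simp
  have vec2_add_single_one : ∀ X Y : ℤ, (![X, Y] : Site 2) + Pi.single 1 1 = ![X, Y + 1] := fun X Y => by
    ext i; fin_cases i <;> simp
  induction n with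
  | zero => simp
  | succ n ih =>
    have h' := ih (fun j hj hjn => h j hj (by omega))
    rw [h']
    have key := walkWinding_eq_walkWinding_up_of_closed p (u := ![X, Y₀ + n])
      (by
        rw [vec2_add_single_one, vec2_add_single_zero]
        have := h (n + 1) (by omega) le_rfl
        push_cast at this ⊢
        rwa [show Y₀ + (n : ℤ) + 1 = Y₀ + (n + 1) by ring])
    rw [vec2_add_single_one] at key
    push_cast
    rwa [show Y₀ + ((n : ℤ) + 1) = Y₀ + n + 1 by ring]

/-! ### Certified sites have certified edges -/

/-- The real coordinates of a lattice site. [folklore] -/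
theorem toComplex_eq_mk (v : Site 2) : Site.toComplex v = ⟨(v 0 : ℝ), (v 1 : ℝ)⟩ := by
  apply Complex.ext <;> simp

/-- **The four closed edges at a certified site.** Let `p` be a closed lattice walk whose polygon
winds `0` times about every point of `K` off the polygon, and let `v ∉ p.support` with
`walkWinding p v ≠ 0`. Then for each of the four lattice neighbours `w` of `v` the closed segment
`[v, w]` lies in `Kᶜ ∪ range (walkPath p)`: the right and upper edges lie in the closed face `v`,
the left edge in the face `v - e₀`, the lower edge in the face `v - e₁`, all three faces carry the
winding number of `v` (`walkWinding_faces_eq_of_not_mem_support`) and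
`face_subset_of_walkWinding_ne_zero'` applies. [folklore] -/
theorem segment_subset_of_walkWinding_ne_zero :
    ∀ (K : Set ℂ) {a : Site 2} (p : (zdGraph 2).Walk a a),
      (∀ q ∈ K, q ∉ range (walkPath p) → wind (fun t => (walkPath p).extend t - q) = 0) →
      ∀ v : Site 2, v ∉ p.support → walkWinding p v ≠ 0 →
      ∀ kk : Fin 4, segment ℝ (Site.toComplex v) (Site.toComplex (v + cornerUnit kk)) ⊆ Kᶜ ∪ range (walkPath p) := by
  intro K a p hK v hv hw kk
  obtain ⟨h₀, h₁, -⟩ := walkWinding_faces_eq_of_not_mem_support p v hv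
  -- the three faces
  have hF := face_subset_of_walkWinding_ne_zero' K p hK v hw
  have hF₀ := face_subset_of_walkWinding_ne_zero' K p hK (v - Pi.single 0 1) (by rwa [h₀])
  have hF₁ := face_subset_of_walkWinding_ne_zero' K p hK (v - Pi.single 1 1) (by rwa [h₁])
  -- coordinates of the endpoints
  have hv' := toComplex_eq_mk v
  have hw' := toComplex_eq_mk (v + cornerUnit kk)
  -- a closed segment between two points of a closed box lies in the box (convexity)
  have hconv : ∀ (u : Site 2), Convex ℝ (Icc (u 0 : ℝ) (u 0 + 1) ×ℂ Icc (u 1 : ℝ) (u 1 + 1)) := by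
    intro u
    have e := Complex.convexHull_reProdIm (Icc (u 0 : ℝ) (u 0 + 1)) (Icc (u 1 : ℝ) (u 1 + 1))
    rw [(convex_Icc _ _).convexHull_eq, (convex_Icc _ _).convexHull_eq] at e
    rw [← e]; exact convex_convexHull ℝ _
  have hsub : ∀ (u : Site 2) (P Q : ℂ), P ∈ (Icc (u 0 : ℝ) (u 0 + 1) ×ℂ Icc (u 1 : ℝ) (u 1 + 1)) →
      Q ∈ (Icc (u 0 : ℝ) (u 0 + 1) ×ℂ Icc (u 1 : ℝ) (u 1 + 1)) →
      segment ℝ P Q ⊆ (Icc (u 0 : ℝ) (u 0 + 1) ×ℂ Icc (u 1 : ℝ) (u 1 + 1)) :=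
    fun u P Q hP hQ => (hconv u).segment_subset hP hQ
  rw [hv', hw']
  fin_cases kk
  · -- right edge, in the face `v`
    refine (hsub v _ _ ?_ ?_).trans hF <;> rw [mem_reProdIm, mem_Icc, mem_Icc] <;> simp [cornerUnit]
  · -- upper edge, in the face `v`
    refine (hsub v _ _ ?_ ?_).trans hF <;> rw [mem_reProdIm, mem_Icc, mem_Icc] <;> simp [cornerUnit]
  · -- left edge, in the face `v - e₀`
    refine (hsub (v - Pi.single 0 1) _ _ ?_ ?_).trans hF₀ <;> rw [mem_reProdIm, mem_Icc, mem_Icc] <;>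
      simp [cornerUnit]
  · -- lower edge, in the face `v - e₁`
    refine (hsub (v - Pi.single 1 1) _ _ ?_ ?_).trans hF₁ <;> rw [mem_reProdIm, mem_Icc, mem_Icc] <;>
      simp [cornerUnit]

end Summit.CriticalPhenomena.SAWScalingLimit.Theorems.AvoidanceLimit.Anchor

end
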